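import Summits.QuantumFields.YangMills.Theorems.FluctuationComparisonRegPrIntLS2BetaCorrLetterL2
import HarnessLib

/-!
# S2β · letter (D)∕(D♮) of GAP♯∘, the (C)-half (UV3-NODE §75.3 «RELATIVE key lemma», px10 lineage) — BRICK 3:
# THE BOND-NEIGHBOURHOOD KERNEL ON THE `Setup` TORUS — the junk of the relative (C)-step carries a LOCAL BOND datum (the comb deviations of ✓`…S2BetaRelativeTentKernel`,
# `dev c = dist1 (U₀(c)⁻¹U(c))` over the bonds `c` based in the `2^d` blocks `z` with `z_κ ∈ {y_κ, y_κ + 1}`); its indicator kernel has row count `≤ 3^d·L^d·d`,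
# column count `≤ 3^d·d²` (Schur: BOUNDED — the junk carries the global plaquette threshold `θ`), hence the `hj` SHAPE `√Σ_Q J(Q)² ≤ c·√((3^dL^dd)(3^dd²))·√Σ_c dev(c)²`

Cell `ym3-torus` (rung R3 = continuum `SU(2)` Yang–Mills on the three-torus — NOT d = 4, NOT infinite volume, NOT a mass gap, NOT Clay).
Width seat «width 10» `ym3-torus-px10` (gen 23), FREE px helper on crux `stmt-QuantumFields-20520`, count-neutral, DEFINITION-FREE; own-risk brick of the px10 lane
«(C)-half of letter (D)» (px16 g21 «GO BRICK 1» 11:28:01Z).  The PLAQUETTE edition is this lineage's ✓`…S2BetaNeighbourhoodKernelTorus` (px10 g22); this file is its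
BOND twin with the forward (`2^d`-block) neighbourhood spelled `∀ κ, blockOf c₋ κ = y κ ∨ blockOf c₋ κ = y κ + 1` in every statement (no `def`).
* §1 `card_bond_filter_blockOf_mem_le` (`≤ |S|·L^d·d`), ★`card_bond_nbhd_le` (ROW COUNT `≤ 3^d·L^d·d`, via
  ✓`card_near_le`: the forward neighbourhood is inside the `3^d` one), ★`card_bond_conbhd_le` (COLUMN COUNT: a fine bond is in the forward neighbourhood of at most `3^d·d²`
  coarse plaquettes).
* §2 ★★`fineBond_nbhd_schur` (`Σ_Q (Σ_{c near Q₋} g c)² ≤ (3^dL^dd)(3^dd²)·Σ_c g c²`, ✓`schur_test_sq`) and ★★`sqrt_sum_sq_le_of_le_fineBond_nbhd_sum` (the `hj` shape).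
PRIOR ART (reused, not retyped): `#{c | c₋ ∈ X} ≤ |X|·d` is px21 g21's ✓`…S2BetaCorrLetterL2.card_filter_bond_src_mem_le`; that file's `bond_nbhd_schur` is the OTHER orientation (coarse BONDS × fine
PLAQUETTES, for the F4 letter) — here rows are coarse PLAQUETTES and columns fine BONDS.

HONEST SCOPE.  Finite combinatorics; no analysis; nothing of Bałaban's is asserted; the relative (C)-step's analytic part, the relative key lemma, (D♮), (F♮), GAP♯∘, S2β, crux 20520 and
`YM3TorusSU2` are NOT proved; no registered stub is closed; the Yang–Mills mass gap is NOT proved.  Sorry-free, axioms standard.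
References: T. Bałaban, CMP **109** (1987) 249–301 [Balaban1987RG1] ((0.1)–(0.3) p.252); CMP **98** (1985) 17–51 [Balaban1985Averaging] ((19) p.21).
-/

set_option autoImplicit false

noncomputable section

namespace Summit.QuantumFields.YangMills.Theorems.FluctuationComparisonRegPrIntLS2BetaBondNeighbourhoodKernel

open Finset
open scoped BigOperators
open Literature.MathematicalPhysics.QuantumFieldTheory.Balaban1983to89
open Summit.QuantumFields.YangMills.Theorems.FluctuationComparisonRegPrIntLS2BetaSchurTest (schur_test_sq)
open Summit.QuantumFields.YangMills.Theorems.FluctuationComparisonRegPrIntLS2BetaNeighbourhoodKernelTorus (card_near_le card_filter_src_mem_le)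
open Summit.QuantumFields.YangMills.Theorems.FluctuationComparisonRegPrIntLS2BetaCorrLetterL2 (card_filter_bond_src_mem_le)

variable {P : Params} {j k : ℕ}

/-! ## §1 Bond counts: row and column sums of the forward bond-neighbourhood kernel -/

/-- `#{c | blockOf c₋ ∈ S} ≤ |S|·L^d·d` (standing range). [cite: Balaban1987RG1, (0.3) p.252] -/
theorem card_bond_filter_blockOf_mem_le (hj : j + 1 ≤ P.m + P.K) (S : Finset (Site P (j + 1))) :
    (Finset.univ.filter (fun c : PBond P j => blockOf c.src ∈ S)).card ≤ S.card * P.L ^ P.d * P.d := by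
  classical
  have hX : (S.biUnion block).card ≤ S.card * P.L ^ P.d := by
    refine Finset.card_biUnion_le.trans (le_of_eq ?_)
    rw [Finset.sum_congr rfl fun z _ => Site.card_block hj z, Finset.sum_const, smul_eq_mul]
  have hsub : Finset.univ.filter (fun c : PBond P j => blockOf c.src ∈ S) ⊆ Finset.univ.filter (fun c : PBond P j => c.src ∈ S.biUnion block) := by
    intro c hc
    rw [Finset.mem_filter] at hc ⊢
    refine ⟨hc.1, Finset.mem_biUnion.mpr ⟨blockOf c.src, hc.2, ?_⟩⟩
    simp [block]
  calc (Finset.univ.filter (fun c : PBond P j => blockOf c.src ∈ S)).card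
      ≤ (Finset.univ.filter (fun c : PBond P j => c.src ∈ S.biUnion block)).card := Finset.card_le_card hsub
    _ ≤ (S.biUnion block).card * P.d := card_filter_bond_src_mem_le _
    _ ≤ S.card * P.L ^ P.d * P.d := Nat.mul_le_mul_right _ hX

/-- ★ **ROW COUNT**: `#{c | ∀ κ, blockOf c₋ κ = y κ ∨ blockOf c₋ κ = y κ + 1} ≤ 3^d·L^d·d` (the forward neighbourhood sits inside the `3^d` one of ✓`card_near_le`; standing range).
[cite: Balaban1987RG1, (0.3) p.252] -/
theorem card_bond_nbhd_le (hj : j + 1 ≤ P.m + P.K) (y : Site P (j + 1)) :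
    (Finset.univ.filter (fun c : PBond P j => ∀ κ, blockOf c.src κ = y κ ∨ blockOf c.src κ = y κ + 1)).card ≤ 3 ^ P.d * P.L ^ P.d * P.d := by
  classical
  set S := Finset.univ.filter (fun z : Site P (j + 1) => ∀ κ, z κ = y κ ∨ z κ = y κ + 1 ∨ z κ = y κ - 1) with hS
  have hsub : Finset.univ.filter (fun c : PBond P j => ∀ κ, blockOf c.src κ = y κ ∨ blockOf c.src κ = y κ + 1) ⊆
      Finset.univ.filter (fun c : PBond P j => blockOf c.src ∈ S) := by
    intro c hc
    rw [Finset.mem_filter] at hc ⊢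
    refine ⟨hc.1, ?_⟩
    rw [hS, Finset.mem_filter]
    exact ⟨Finset.mem_univ _, fun κ => (hc.2 κ).elim Or.inl (fun h => Or.inr (Or.inl h))⟩
  exact (Finset.card_le_card hsub).trans
    ((card_bond_filter_blockOf_mem_le hj S).trans (Nat.mul_le_mul_right _ (Nat.mul_le_mul_right _ (card_near_le y))))

/-- ★ **COLUMN COUNT**: a fine bond `c` lies in the forward neighbourhood of `Q₋` for at most `3^d·d²` coarse plaquettes `Q` (the coarse corners `Q₋` with
`Q₋ κ ∈ {blockOf c₋ κ, blockOf c₋ κ − 1}` are near `blockOf c₋`, times the `≤ d²` direction pairs). [cite: Balaban1987RG1, (0.3) p.252] -/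
theorem card_bond_conbhd_le (c : PBond P j) :
    (Finset.univ.filter (fun Q : Plaq P (j + 1) => ∀ κ, blockOf c.src κ = Q.src κ ∨ blockOf c.src κ = Q.src κ + 1)).card ≤ 3 ^ P.d * P.d ^ 2 := by
  classical
  set S := Finset.univ.filter (fun z : Site P (j + 1) => ∀ κ, z κ = blockOf c.src κ ∨ z κ = blockOf c.src κ + 1 ∨ z κ = blockOf c.src κ - 1)
    with hS
  have hsub : Finset.univ.filter (fun Q : Plaq P (j + 1) => ∀ κ, blockOf c.src κ = Q.src κ ∨ blockOf c.src κ = Q.src κ + 1) ⊆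
      Finset.univ.filter (fun Q : Plaq P (j + 1) => Q.src ∈ S) := by
    intro Q hQ
    rw [Finset.mem_filter] at hQ ⊢
    refine ⟨hQ.1, ?_⟩
    rw [hS, Finset.mem_filter]
    refine ⟨Finset.mem_univ _, fun κ => ?_⟩
    rcases hQ.2 κ with h | h
    · exact Or.inl h.symm
    · right; right; rw [h]; ring
  exact (Finset.card_le_card hsub).trans ((card_filter_src_mem_le S).trans (Nat.mul_le_mul_right _ (card_near_le _)))

/-! ## §2 The Schur bound and the `hj` shape -/

/-- ★★ **SCHUR BOUND FOR THE FORWARD BOND-NEIGHBOURHOOD KERNEL** (✓`schur_test_sq` with the indicator kernel, rows `≤ 3^d·L^d·d`, columns `≤ 3^d·d²`):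
`Σ_Q (Σ_{c : ∀ κ, blockOf c₋ κ ∈ {Q₋ κ, Q₋ κ + 1}} g c)² ≤ (3^d·L^d·d)·(3^d·d²)·Σ_c g c²`. [cite: Balaban1985Averaging, (19) p.21] -/
theorem fineBond_nbhd_schur (hj : j + 1 ≤ P.m + P.K) (g : PBond P j → ℝ) :
    ∑ Q : Plaq P (j + 1), (∑ c ∈ Finset.univ.filter (fun c : PBond P j => ∀ κ, blockOf c.src κ = Q.src κ ∨ blockOf c.src κ = Q.src κ + 1), g c) ^ 2 ≤
      ((3 ^ P.d * P.L ^ P.d * P.d : ℕ) : ℝ) * ((3 ^ P.d * P.d ^ 2 : ℕ) : ℝ) * ∑ c : PBond P j, g c ^ 2 := by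
  classical
  have h := schur_test_sq (Finset.univ : Finset (Plaq P (j + 1))) (Finset.univ : Finset (PBond P j))
    (fun Q c => if (∀ κ, blockOf c.src κ = Q.src κ ∨ blockOf c.src κ = Q.src κ + 1) then (1 : ℝ) else 0)
    (fun Q _ c _ => by positivity) (R := ((3 ^ P.d * P.L ^ P.d * P.d : ℕ) : ℝ)) (C := ((3 ^ P.d * P.d ^ 2 : ℕ) : ℝ)) (by positivity)
    (fun Q _ => by
      rw [← Finset.sum_filter, Finset.sum_const, nsmul_eq_mul, mul_one]
      exact_mod_cast card_bond_nbhd_le hj Q.src)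
    (fun c _ => by
      rw [← Finset.sum_filter, Finset.sum_const, nsmul_eq_mul, mul_one]
      exact_mod_cast card_bond_conbhd_le c) g
  simp only [ite_mul, one_mul, zero_mul, Finset.sum_ite, Finset.sum_const_zero, add_zero] at h
  convert h using 4

/-- ★★ **THE `hj` SHAPE FOR A LOCAL BOND DATUM**: if a non-negative coarse-plaquette function is dominated by `c ×` the forward bond-neighbourhood sum of a fine-bond function,
its `ℓ²` norm is dominated by `c·√((3^d L^d d)(3^d d²)) ×` the `ℓ²` norm of the bond function. [cite: Balaban1985Averaging, (19) p.21] -/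
theorem sqrt_sum_sq_le_of_le_fineBond_nbhd_sum (hj : j + 1 ≤ P.m + P.K) (g : PBond P j → ℝ) (J : Plaq P (j + 1) → ℝ) {c : ℝ} (hc : 0 ≤ c)
    (hJ0 : ∀ Q, 0 ≤ J Q)
    (hJ : ∀ Q, J Q ≤ c * ∑ b ∈ Finset.univ.filter (fun b : PBond P j => ∀ κ, blockOf b.src κ = Q.src κ ∨ blockOf b.src κ = Q.src κ + 1), g b) :
    √(∑ Q : Plaq P (j + 1), J Q ^ 2) ≤
      c * √(((3 ^ P.d * P.L ^ P.d * P.d : ℕ) : ℝ) * ((3 ^ P.d * P.d ^ 2 : ℕ) : ℝ)) * √(∑ b : PBond P j, g b ^ 2) := by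
  have h1 : ∑ Q : Plaq P (j + 1), J Q ^ 2 ≤ c ^ 2 * ∑ Q : Plaq P (j + 1),
      (∑ b ∈ Finset.univ.filter (fun b : PBond P j => ∀ κ, blockOf b.src κ = Q.src κ ∨ blockOf b.src κ = Q.src κ + 1), g b) ^ 2 := by
    rw [Finset.mul_sum]
    refine Finset.sum_le_sum fun Q _ => ?_
    rw [← mul_pow]
    exact pow_le_pow_left₀ (hJ0 Q) (hJ Q) 2
  have h2 := fineBond_nbhd_schur hj g
  calc √(∑ Q : Plaq P (j + 1), J Q ^ 2)
      ≤ √(c ^ 2 * (((3 ^ P.d * P.L ^ P.d * P.d : ℕ) : ℝ) * ((3 ^ P.d * P.d ^ 2 : ℕ) : ℝ) * ∑ b : PBond P j, g b ^ 2)) :=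
        Real.sqrt_le_sqrt (h1.trans (mul_le_mul_of_nonneg_left h2 (sq_nonneg c)))
    _ = c * √(((3 ^ P.d * P.L ^ P.d * P.d : ℕ) : ℝ) * ((3 ^ P.d * P.d ^ 2 : ℕ) : ℝ)) * √(∑ b : PBond P j, g b ^ 2) := by
        rw [Real.sqrt_mul (sq_nonneg c), Real.sqrt_sq hc, Real.sqrt_mul (by positivity)]; ring

end Summit.QuantumFields.YangMills.Theorems.FluctuationComparisonRegPrIntLS2BetaBondNeighbourhoodKernel

end
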